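import Mathlib
import Summits.Ventures.PercRepro2.V2SP
import Summits.Ventures.PercRepro2.HallOffFrame
import Summits.Ventures.PercRepro2.HallOffAxis
import Summits.Ventures.PercRepro2.Tail2DCount
import Summits.Ventures.PercRepro2.Tail2DThreePoint
import Summits.Ventures.PercRepro2.Tail2DP2Series
import Summits.Ventures.PercRepro2.Tail2DDisjointPaths
import Summits.Ventures.PercRepro2.Tail2DP2SeriesSP
import Summits.Ventures.PercRepro2.Tail2DAxisUnimodal
import Summits.Ventures.PercRepro2.Tail2DOffAxis31
import Summits.Ventures.PercRepro2.Tail2DRowOne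
import Summits.Ventures.PercRepro2.Tail2DStepRowZero
import Summits.Ventures.PercRepro2.Tail2DStepCert
import Summits.Ventures.PercRepro2.Tail2DOffAxisCert
import Summits.Ventures.PercRepro2.Tail2DStepFour
import Summits.Ventures.PercRepro2.Tail2DStepFive
import Summits.Ventures.PercRepro2.Tail2DOffAxisSixCertA
import Summits.Ventures.PercRepro2.Tail2DOffAxisSixCertB

/-!
# The off-axis members `(6,2)`, `(6,3)`, `(6,4)` on every series–parallel network
(seat mine-b, cell pub-perc-repro2; MINE-B.md §37.8)

`T(6,2) ≤ T(5,3)`, `T(6,3) ≤ T(5,4)` and `T(6,4) ≤ T(5,5)` (`t62_le_t53`, `t63_le_t54`, `t64_le_t55`), proved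
together by induction over the grammar: the parallel steps are the certificates `off62_par`, `off63_par`,
`off64_par` over the STEP members with `j ≤ 5` (`step_row_zero`, `step_one_three`, `step_four`, `step_five`),
the axis and row-`1` weights, the landed members `(4,2)`, `(5,2)`, `(5,3)` and the three members themselves;
the series steps multiply the tails (`card_tail_ser`).  With these, the off-axis family `T(a,j) ≤ T(a−1,j+1)`
is a theorem on all of SP for every `a ≤ 6` and for the rows `j = 0, 1` at every `a`.
-/

namespace Summit.Ventures.PercRepro2.Tail2D

open V2Closure

/-- **the off-axis members `(6,2)`, `(6,3)`, `(6,4)` on every pattern of the grammar** -/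
theorem offaxis_six : ∀ s : V2Closure.SP,
    ((Finset.univ.filter (fun y : s.Conf => 6 ≤ s.rLab y ∧ 2 ≤ s.bLab y)).card
      ≤ (Finset.univ.filter (fun y : s.Conf => 6 - 1 ≤ s.rLab y ∧ 2 + 1 ≤ s.bLab y)).card)
    ∧ ((Finset.univ.filter (fun y : s.Conf => 6 ≤ s.rLab y ∧ 3 ≤ s.bLab y)).card
      ≤ (Finset.univ.filter (fun y : s.Conf => 6 - 1 ≤ s.rLab y ∧ 3 + 1 ≤ s.bLab y)).card)
    ∧ ((Finset.univ.filter (fun y : s.Conf => 6 ≤ s.rLab y ∧ 4 ≤ s.bLab y)).card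
      ≤ (Finset.univ.filter (fun y : s.Conf => 6 - 1 ≤ s.rLab y ∧ 4 + 1 ≤ s.bLab y)).card)
  | .free => ⟨offaxis_atom .free (Or.inl rfl) 6 2 (by norm_num), offaxis_atom .free (Or.inl rfl) 6 3 (by norm_num),
      offaxis_atom .free (Or.inl rfl) 6 4 (by norm_num)⟩
  | .pin => ⟨offaxis_atom .pin (Or.inr (Or.inl rfl)) 6 2 (by norm_num), offaxis_atom .pin (Or.inr (Or.inl rfl)) 6 3 (by norm_num),
      offaxis_atom .pin (Or.inr (Or.inl rfl)) 6 4 (by norm_num)⟩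
  | .absent => ⟨offaxis_atom .absent (Or.inr (Or.inr rfl)) 6 2 (by norm_num), offaxis_atom .absent (Or.inr (Or.inr rfl)) 6 3 (by norm_num),
      offaxis_atom .absent (Or.inr (Or.inr rfl)) 6 4 (by norm_num)⟩
  | .ser s t => by
    have ihs := offaxis_six s
    have iht := offaxis_six t
    refine ⟨?_, ?_, ?_⟩ <;> rw [card_tail_ser, card_tail_ser]
    · exact Nat.mul_le_mul ihs.1 iht.1
    · exact Nat.mul_le_mul ihs.2.1 iht.2.1
    · exact Nat.mul_le_mul ihs.2.2 iht.2.2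
  | .par s t => by
    have ihs := offaxis_six s
    have iht := offaxis_six t
    exact ⟨(offaxis_iff (.par s t) 6 2 (by norm_num)).2 (off62_par s t (le_of_eq (sum_phi_offset_one_zero s 2).symm) (SP.hallFn_phi_axis_count s 4 (by norm_num)) (SP.sum_phi_row_nonneg s 4 (by norm_num)) ((offaxis_iff s 4 2 (by norm_num)).1 (t42_le_t33 s)) (SP.hallFn_phi_axis_count s 5 (by norm_num)) (SP.sum_phi_row_nonneg s 5 (by norm_num)) ((offaxis_iff s 5 2 (by norm_num)).1 (t52_le_t43 s)) (SP.hallFn_phi_axis_count s 6 (by norm_num)) (SP.sum_phi_row_nonneg s 6 (by norm_num)) ((offaxis_iff s 6 2 (by norm_num)).1 ihs.1) (SP.sum_psi_zero_nonneg s 3 (by norm_num)) (SP.sum_psi_zero_nonneg s 4 (by norm_num)) ((step_iff' s 1 4).1 (step_four s).1) (SP.hallFn_phi_axis_count t 3 (by norm_num)) (SP.sum_phi_row_nonneg t 3 (by norm_num)) (le_of_eq (sum_phi_offset_one_zero t 2).symm) (SP.hallFn_phi_axis_count t 4 (by norm_num)) (SP.sum_phi_row_nonneg t 4 (by norm_num))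 ((offaxis_iff t 4 2 (by norm_num)).1 (t42_le_t33 t)) (SP.hallFn_phi_axis_count t 5 (by norm_num)) (SP.sum_phi_row_nonneg t 5 (by norm_num)) ((offaxis_iff t 5 2 (by norm_num)).1 (t52_le_t43 t)) (SP.hallFn_phi_axis_count t 6 (by norm_num)) (SP.sum_phi_row_nonneg t 6 (by norm_num)) ((offaxis_iff t 6 2 (by norm_num)).1 iht.1) (SP.sum_psi_zero_nonneg t 4 (by norm_num))),
      (offaxis_iff (.par s t) 6 3 (by norm_num)).2 (off63_par s t (SP.hallFn_phi_axis_count s 3 (by norm_num)) (SP.sum_phi_row_nonneg s 3 (by norm_num)) ((offaxis_iff s 4 2 (by norm_num)).1 (t42_le_t33 s)) (le_of_eq (sum_phi_offset_one_zero s 3).symm) (SP.hallFn_phi_axis_count s 5 (by norm_num)) (SP.sum_phi_row_nonneg s 5 (by norm_num)) ((offaxis_iff s 5 2 (by norm_num)).1 (t52_le_t43 s)) ((offaxis_iff s 5 3 (by norm_num)).1 (t53_le_t44 s)) (SP.hallFn_phi_axis_count s 6 (by norm_num)) (SP.sum_phi_row_nonneg s 6 (by norm_num)) ((offaxis_iff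 s 6 2 (by norm_num)).1 ihs.1) ((offaxis_iff s 6 3 (by norm_num)).1 ihs.2.1) (SP.sum_psi_zero_nonneg s 4 (by norm_num)) ((step_iff' s 1 3).1 (step_one_three s)) ((step_iff' s 1 4).1 (step_four s).1) (SP.hallFn_phi_axis_count t 3 (by norm_num)) (SP.sum_phi_row_nonneg t 3 (by norm_num)) ((offaxis_iff t 4 2 (by norm_num)).1 (t42_le_t33 t)) (le_of_eq (sum_phi_offset_one_zero t 3).symm) (SP.hallFn_phi_axis_count t 5 (by norm_num)) (SP.sum_phi_row_nonneg t 5 (by norm_num)) ((offaxis_iff t 5 2 (by norm_num)).1 (t52_le_t43 t)) ((offaxis_iff t 5 3 (by norm_num)).1 (t53_le_t44 t)) (SP.hallFn_phi_axis_count t 6 (by norm_num)) (SP.sum_phi_row_nonneg t 6 (by norm_num)) ((offaxis_iff t 6 2 (by norm_num)).1 iht.1) ((offaxis_iff t 6 3 (by norm_num)).1 iht.2.1) (SP.sum_psi_zero_nonneg t 4 (by norm_num)) (SP.sum_psi_zero_nonneg t 5 (by norm_num)) ((step_iff' t 1 3).1 (step_one_three t)) ((step_iff' t 1 4).1 (step_four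 t).1)),
      (offaxis_iff (.par s t) 6 4 (by norm_num)).2 (off64_par s t (SP.hallFn_phi_axis_count s 2 (by norm_num)) (le_of_eq (sum_phi_offset_one_zero s 1).symm) (SP.sum_phi_row_nonneg s 3 (by norm_num)) ((offaxis_iff s 4 2 (by norm_num)).1 (t42_le_t33 s)) (le_of_eq (sum_phi_offset_one_zero s 3).symm) (le_of_eq (sum_phi_offset_one_zero s 4).symm) (SP.hallFn_phi_axis_count s 6 (by norm_num)) (SP.sum_phi_row_nonneg s 6 (by norm_num)) ((offaxis_iff s 6 2 (by norm_num)).1 ihs.1) ((offaxis_iff s 6 3 (by norm_num)).1 ihs.2.1) ((offaxis_iff s 6 4 (by norm_num)).1 ihs.2.2) (SP.sum_psi_zero_nonneg s 3 (by norm_num)) (SP.sum_psi_zero_nonneg s 4 (by norm_num)) (SP.sum_psi_zero_nonneg s 5 (by norm_num)) ((step_iff' s 1 4).1 (step_four s).1) ((step_iff' s 1 5).1 (step_five s).1) ((step_iff' s 2 5).1 (step_five s).2.1) ((step_iff' s 3 5).1 (step_five s).2.2) (SP.hallFn_phi_axis_count t 2 (by norm_num)) (SP.sum_phi_row_nonneg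 t 3 (by norm_num)) (le_of_eq (sum_phi_offset_one_zero t 2).symm) ((offaxis_iff t 4 2 (by norm_num)).1 (t42_le_t33 t)) (le_of_eq (sum_phi_offset_one_zero t 4).symm) (SP.hallFn_phi_axis_count t 6 (by norm_num)) (SP.sum_phi_row_nonneg t 6 (by norm_num)) ((offaxis_iff t 6 2 (by norm_num)).1 iht.1) ((offaxis_iff t 6 3 (by norm_num)).1 iht.2.1) ((offaxis_iff t 6 4 (by norm_num)).1 iht.2.2) (SP.sum_psi_zero_nonneg t 3 (by norm_num)) (SP.sum_psi_zero_nonneg t 4 (by norm_num)) (SP.sum_psi_zero_nonneg t 5 (by norm_num)) ((step_iff' t 1 4).1 (step_four t).1) ((step_iff' t 1 5).1 (step_five t).1) ((step_iff' t 2 5).1 (step_five t).2.1) ((step_iff' t 3 5).1 (step_five t).2.2))⟩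

/-- **six edge-disjoint red paths with two edge-disjoint blue paths are rarer than five and three**: `T(6,2) ≤ T(5,3)` -/
theorem t62_le_t53 (s : V2Closure.SP) :
    (Finset.univ.filter (fun y : s.Conf => 6 ≤ s.rLab y ∧ 2 ≤ s.bLab y)).card
      ≤ (Finset.univ.filter (fun y : s.Conf => 5 ≤ s.rLab y ∧ 3 ≤ s.bLab y)).card :=
  (offaxis_six s).1

/-- `T(6,3) ≤ T(5,4)` -/
theorem t63_le_t54 (s : V2Closure.SP) :
    (Finset.univ.filter (fun y : s.Conf => 6 ≤ s.rLab y ∧ 3 ≤ s.bLab y)).card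
      ≤ (Finset.univ.filter (fun y : s.Conf => 5 ≤ s.rLab y ∧ 4 ≤ s.bLab y)).card :=
  (offaxis_six s).2.1

/-- `T(6,4) ≤ T(5,5)` -/
theorem t64_le_t55 (s : V2Closure.SP) :
    (Finset.univ.filter (fun y : s.Conf => 6 ≤ s.rLab y ∧ 4 ≤ s.bLab y)).card
      ≤ (Finset.univ.filter (fun y : s.Conf => 5 ≤ s.rLab y ∧ 5 ≤ s.bLab y)).card :=
  (offaxis_six s).2.2

/-- the three members in the vocabulary of `Tail2DP2Series` -/
theorem stat_offaxis_six (s : V2Closure.SP) :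
    stat s (fun r b => 6 ≤ r ∧ 2 ≤ b) ≤ stat s (fun r b => 5 ≤ r ∧ 3 ≤ b)
    ∧ stat s (fun r b => 6 ≤ r ∧ 3 ≤ b) ≤ stat s (fun r b => 5 ≤ r ∧ 4 ≤ b)
    ∧ stat s (fun r b => 6 ≤ r ∧ 4 ≤ b) ≤ stat s (fun r b => 5 ≤ r ∧ 5 ≤ b) :=
  ⟨t62_le_t53 s, t63_le_t54 s, t64_le_t55 s⟩

end Summit.Ventures.PercRepro2.Tail2D
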